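import Mathlib
import HarnessLib
import Summits.HubbardSuperconductivity.HubbardSuperconductivity.Theorems.KLProgrammeKLRegimeTwoPointAssemblyDefs
import Literature.MathematicalPhysics.QuantumLattice.SymmetricRegimeFunctionals

/-!
# Child 4 `KLRegimeTwoPointAssembly` of crux K3 — objects of the LIMIT analysis of its skeleton (V7 cut, line `asm-repr`;
# seat hubbard-kl-r2d-p2): the frame propagator, the equal-time site phase, and the free / interacting DIAGONAL parts of the
# representation `twoPointReprCT`

Definitions with bodies only (finite `(β, L, M)`):
* `propCT L M β μ K k = ĝ_K(k) = 1/(−iω_k + e_K(k⃗))` — the free propagator of the renormalised band (BGM 2003 (2.6));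
* `sitePhase L k⃗ x̄ ȳ = e^{i p_{k⃗}·(x̄ − ȳ)}` (torus representatives) — the product of the two `fieldCoeff`s of `twoPointReprCT` is
  `(βL²)⁻² · sitePhase` at imaginary time `0`;
* `reprFree L M β μ K σ σ' x̄ ȳ = −δ_{σσ'} (βL²)⁻¹ Σ_k e^{ip·(x̄−ȳ)} ĝ_K(k)` — the free two-point function of the frame;
* `reprInt L M β U μ K σ σ' x̄ ȳ = δ_{σσ'} (βL²)⁻¹ Σ_k e^{ip·(x̄−ȳ)} ĝ_K(k)² Σ̂_{L,M}(k,σ)` — the propagator-dressed two-leg vertex function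
  (`selfEnergy`) of the fully integrated countertermed action `fullActionCT`.
By conservation (`…TwoPointAssemblyConservation`) and the pair function of `C^K`, `twoPointReprCT = reprFree + reprInt`
(the skeleton's `stub_asm_diag`); the volume-limit slot `FinalTwoLegVolLimit` (`…KLRegimeVolumeLimitDefs`) controls `reprInt`.
Nothing is asserted about the model here.
-/

noncomputable section

namespace Summit.HubbardSuperconductivity.HubbardSuperconductivity.Theorems.TwoPointAssembly

set_option linter.dupNamespace false -- summit = problem name (single-conjunct summit), D-0017

open Literature.MathematicalPhysics.QuantumLattice Literature.Probability.LatticeModels GrassmannAlgebra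

section Objects

variable (L M : ℕ) [NeZero L]

/-- The free propagator of the frame, `ĝ_K(k) = 1/(−iω_k + e_K(k⃗))` (`e_K = nambuXiCT`). -/
def propCT (β μ : ℝ) (K : TrigPolyC4v) (k : FreqMomentum L M) : ℂ :=
  1 / (-Complex.I * (matsubaraFreq β M k.1 : ℂ) + (nambuXiCT L μ K k.2 : ℂ))

/-- The equal-time site phase `e^{i p_{k⃗}·(x̄ − ȳ)}` (torus representatives `ZMod.val`, `p_{k⃗} = latticeMomentum L k⃗`). -/
def sitePhase (k xe ye : TorusSite 2 L) : ℂ :=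
  Complex.exp (Complex.I * ((∑ i : Fin 2, latticeMomentum L k i * (((xe i).val : ℝ) - ((ye i).val : ℝ)) : ℝ) : ℂ))

/-- **The free part of the representation**: `−δ_{σσ'} (βL²)⁻¹ Σ_k e^{ip·(x̄−ȳ)} ĝ_K(k)`. -/
def reprFree (β μ : ℝ) (K : TrigPolyC4v) (σ σ' : Fin 2) (xe ye : TorusSite 2 L) : ℂ :=
  if σ = σ' then -(∑ k : FreqMomentum L M, sitePhase L k.2 xe ye * propCT L M β μ K k) / ((β * (L : ℝ) ^ 2 : ℝ) : ℂ) else 0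

/-- **The interacting part of the representation**: `δ_{σσ'} (βL²)⁻¹ Σ_k e^{ip·(x̄−ȳ)} ĝ_K(k)² Σ̂_{L,M}(k, σ)`, `Σ̂` the two-leg vertex
function `selfEnergy` of the fully integrated countertermed action `fullActionCT`. -/
def reprInt (β U μ : ℝ) (K : TrigPolyC4v) (σ σ' : Fin 2) (xe ye : TorusSite 2 L) : ℂ :=
  if σ = σ' then
    (∑ k : FreqMomentum L M, sitePhase L k.2 xe ye * propCT L M β μ K k ^ 2 * selfEnergy L M β (fullActionCT L M β U μ K) k σ) /
      ((β * (L : ℝ) ^ 2 : ℝ) : ℂ)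
  else 0

/-- Off the spin diagonal the free part vanishes. -/
theorem reprFree_of_ne (β μ : ℝ) (K : TrigPolyC4v) {σ σ' : Fin 2} (h : σ ≠ σ') (xe ye : TorusSite 2 L) :
    reprFree L M β μ K σ σ' xe ye = 0 := by
  rw [reprFree, if_neg h]

/-- Off the spin diagonal the interacting part vanishes. -/
theorem reprInt_of_ne (β U μ : ℝ) (K : TrigPolyC4v) {σ σ' : Fin 2} (h : σ ≠ σ') (xe ye : TorusSite 2 L) :
    reprInt L M β U μ K σ σ' xe ye = 0 := by
  rw [reprInt, if_neg h]

end Objects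

end Summit.HubbardSuperconductivity.HubbardSuperconductivity.Theorems.TwoPointAssembly

end
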